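import Literature.NumberTheory.EllipticCurves.TateModuleStableLatticeMemberProofs
import Literature.NumberTheory.EllipticCurves.Kato2004.StableLatticeHomothetyProofs
import Literature.NumberTheory.EllipticCurves.TateModuleFixedPointsProofs
import HarnessLib

/-!
# Every Galois-stable `ℤ_p`-lattice of `V_pE` is the Tate module of an isogenous curve — the `V_pE` form

Topic `NumberTheory/EllipticCurves`; proofs-only (theorems only; no definitions, no named facts).
Sequel of `TateModuleStableLatticeMemberProofs.lean` (the `T_pE` form: a stable `p^nT_pE ⊆ L ⊆ T_pE`
is `T_p` of a `K`-isogenous curve, Silverman *AEC* III.4.12 + III.§7), in the currency in which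
Kato's member of an isogeny class is printed: a `Γ`-stable LATTICE OF `V_pE` — Kato, Astérisque
295 (2004), 8.3 p. 181 / 14.10 p. 241 / 17.5 p. 274 (`T = V_{O_λ}(f)(1)`, a `Gal(ℚ̄/ℚ)`-stable
`ℤ_p`-lattice of `V_{ℚ_p}(f)(1) ≅ V_pE`); Wuthrich, Doc. Math. 19 (2014) §3.2 p. 394.

THE STATEMENT (`WeierstrassCurve.exists_isogeny_tateModule_equiv_of_stableRationalLattice`). Let `E/K`
be an elliptic curve over a perfect field, `p` a prime, and `Λ ⊆ V_pE = ℚ_p ⊗_{ℤ_p} T_pE` a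
finitely generated `Γ_K`-stable `ℤ_p`-submodule which SPANS `V_pE` over `ℚ_p` (a lattice). Then
there are an elliptic curve `E'/K`, a `K`-isogeny `E → E'`, and a `Γ_K`-equivariant `ℤ_p`-linear
isomorphism `Λ ≅ T_pE'`. Over `ℚ`, `E'` may be taken globally minimal
(`…_isGloballyMinimal_…_of_stableRationalLattice`).

THE PROOF. Clear denominators (`V_pE` is the localisation of `T_pE`): `N₀ • Λ ⊆ T_pE` for one
`N₀ ∈ ℤ_p ∖ 0` (generator by generator, `RationalTateModule.exists_smul_eq_toRational`), so
`L := {x ∈ T_pE | 1 ⊗ x ∈ N₀Λ}` is a stable submodule of `T_pE`, `ℤ_p`-isomorphic to `Λ` by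
`x ↦ N₀⁻¹(1 ⊗ x)` (`T_pE ↪ V_pE`, `TateModule.toRational_injective`); since `Λ` spans and `T_pE` is
finitely generated (`module_finite_tateModule_holds`), `p^n T_pE ⊆ L` for some `n`; now apply the
`T_pE` form to `L`.

References: [SilvermanAEC2009] Prop. III.4.12, Rem. III.4.13.2, III.§7, Cor. VIII.8.3;
[Kato2004Asterisque] 8.3 (p. 181), 14.10 (p. 241), 17.5 (p. 274); [Wuthrich2014] §3.2 (p. 394);
[Serre1968] I.1.1 (`V_p = ℚ_p ⊗ T_p`).
-/

noncomputable section

open scoped Classical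

universe u

namespace Literature.NumberTheory.EllipticCurves

open _root_.WeierstrassCurve Field

section Construction

variable {K : Type u} [Field K] [PerfectField K] (W : WeierstrassCurve K) [W.IsElliptic]
  (p : ℕ) [hp : Fact p.Prime]

omit [PerfectField K] [W.IsElliptic] in
/-- (Private helper; = the private `exists_smul_mem_range_toRational_of_fg` of
`Kato2004/StableLatticeHomothetyProofs.lean`.) Common denominators: a finitely generated
`ℤ_p`-submodule `Λ` of `V_pE` satisfies `N • Λ ⊆ T_pE` for one non-zero `N ∈ ℤ_p`. [folklore] -/
private theorem exists_smul_mem_range_toRational_of_fg'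
    {Λ : Submodule ℤ_[p] (W.rationalTateModule p)} (hfg : Λ.FG) :
    ∃ N : ℤ_[p], N ≠ 0 ∧ ∀ v ∈ Λ, ∃ x : W.tateModule p,
      (N : ℚ_[p]) • v = TateModule.toRational p x := by
  obtain ⟨s, rfl⟩ := hfg
  have hgen : ∀ v : W.rationalTateModule p, ∃ N : ℤ_[p], N ≠ 0 ∧ ∃ x : W.tateModule p,
      (N : ℚ_[p]) • v = TateModule.toRational p x :=
    fun v ↦ RationalTateModule.exists_smul_eq_toRational v
  choose d hd0 hd using hgen
  have hιsmul : ∀ (c : ℤ_[p]) (y : W.tateModule p),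
      (TateModule.toRational p (c • y) : W.rationalTateModule p) = (c : ℚ_[p]) • TateModule.toRational p y :=
    fun c y ↦ by rw [map_smul, ← algebraMap_smul ℚ_[p] c (TateModule.toRational p y)]; rfl
  refine ⟨∏ v ∈ s, d v, Finset.prod_ne_zero_iff.mpr fun v _ ↦ hd0 v, fun v hv ↦ ?_⟩
  refine Submodule.span_induction (p := fun v _ ↦ ∃ x : W.tateModule p,
      ((∏ v ∈ s, d v : ℤ_[p]) : ℚ_[p]) • v = TateModule.toRational p x) ?_ ?_ ?_ ?_ hv
  · intro v hvs
    obtain ⟨x, hx⟩ := hd v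
    obtain ⟨M, hM⟩ : ∃ M : ℤ_[p], ∏ w ∈ s, d w = M * d v :=
      ⟨∏ w ∈ s.erase v, d w, (Finset.prod_erase_mul s d hvs).symm⟩
    refine ⟨M • x, ?_⟩
    rw [hM, PadicInt.coe_mul, mul_smul, hx, hιsmul]
  · exact ⟨0, by rw [smul_zero, map_zero]⟩
  · rintro v w - - ⟨x, hx⟩ ⟨y, hy⟩
    exact ⟨x + y, by rw [smul_add, hx, hy, map_add]⟩
  · rintro c v - ⟨x, hx⟩
    refine ⟨c • x, ?_⟩
    rw [hιsmul, ← hx, ← algebraMap_smul ℚ_[p] c v, smul_comm]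
    rfl

omit [PerfectField K] [W.IsElliptic] in
/-- (Private helper.) Every element of the `ℚ_p`-span of a `ℤ_p`-submodule `Λ ⊆ V_pE` has a
non-zero `ℤ_p`-multiple in `Λ` (`ℚ_p` is the fraction field of `ℤ_p`). [folklore] -/
private theorem exists_smul_mem_of_mem_span (Λ : Submodule ℤ_[p] (W.rationalTateModule p))
    {w : W.rationalTateModule p} (hw : w ∈ Submodule.span ℚ_[p] (Λ : Set (W.rationalTateModule p))) :
    ∃ M : ℤ_[p], M ≠ 0 ∧ (M : ℚ_[p]) • w ∈ Λ := by
  have hzs : ∀ (c : ℤ_[p]) (x : W.rationalTateModule p), (c : ℚ_[p]) • x = c • x :=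
    fun c x ↦ algebraMap_smul ℚ_[p] c x
  refine Submodule.span_induction (p := fun w _ ↦ ∃ M : ℤ_[p], M ≠ 0 ∧ (M : ℚ_[p]) • w ∈ Λ)
    ?_ ?_ ?_ ?_ hw
  · intro w hw
    exact ⟨1, one_ne_zero, by rw [PadicInt.coe_one, one_smul]; exact hw⟩
  · exact ⟨1, one_ne_zero, by rw [smul_zero]; exact Λ.zero_mem⟩
  · rintro v w - - ⟨M, hM, hv⟩ ⟨M', hM', hw⟩
    refine ⟨M * M', mul_ne_zero hM hM', ?_⟩
    have h1 : ((M * M' : ℤ_[p]) : ℚ_[p]) • (v + w) =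
        (M' : ℚ_[p]) • ((M : ℚ_[p]) • v) + (M : ℚ_[p]) • ((M' : ℚ_[p]) • w) := by
      rw [smul_add, PadicInt.coe_mul, smul_smul, smul_smul, mul_comm (M' : ℚ_[p])]
    rw [h1, hzs M', hzs M ((M' : ℚ_[p]) • w)]
    exact Λ.add_mem (Λ.smul_mem M' hv) (Λ.smul_mem M hw)
  · rintro c v - ⟨M, hM, hv⟩
    obtain ⟨⟨a, s⟩, has⟩ := IsLocalization.surj (nonZeroDivisors ℤ_[p]) c
    change c * ((s : ℤ_[p]) : ℚ_[p]) = (a : ℚ_[p]) at has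
    refine ⟨M * s, mul_ne_zero hM (nonZeroDivisors.coe_ne_zero s), ?_⟩
    have h1 : ((M * (s : ℤ_[p]) : ℤ_[p]) : ℚ_[p]) • (c • v) = (a : ℚ_[p]) • ((M : ℚ_[p]) • v) := by
      rw [PadicInt.coe_mul, smul_smul, smul_smul, mul_assoc, mul_comm ((s : ℤ_[p]) : ℚ_[p]), has,
        mul_comm]
    rw [h1, hzs a]
    exact Λ.smul_mem a hv

/-- **Every `Γ_K`-stable `ℤ_p`-lattice of `V_pE` is the Tate module of a `K`-isogenous curve.**
For an elliptic curve `E/K` (`K` perfect), a prime `p`, and a finitely generated `Γ_K`-stable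
`ℤ_p`-submodule `Λ ⊆ V_pE = ℚ_p ⊗_{ℤ_p} T_pE` spanning `V_pE` over `ℚ_p`: there are an elliptic
curve `E'/K`, a `K`-isogeny `E → E'` and a `Γ_K`-equivariant `ℤ_p`-linear isomorphism `Λ ≅ T_pE'`
(clear denominators into `T_pE`, then `exists_isogeny_tateModule_equiv_of_stableLattice` =
Silverman *AEC* III.4.12 / Rem. III.4.13.2 + III.§7). The currency of Kato's member `E_K`
(`T_pE_K ≅ V_{ℤ_p}(f)(1) ⊂ V_pE`, Astérisque 295, 8.3 / 14.10 / 17.5).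
[cite: SilvermanAEC2009, Prop. III.4.12 with Rem. III.4.13.2, and III.7]
[cite: Kato2004Asterisque, 8.3 (p. 181), 14.10 (p. 241) and 17.5 (p. 274)] [cite: Serre1968, I.1.1] -/
theorem _root_.WeierstrassCurve.exists_isogeny_tateModule_equiv_of_stableRationalLattice
    {Λ : Submodule ℤ_[p] (W.rationalTateModule p)} (hfg : Λ.FG)
    (hGal : ∀ (σ : absoluteGaloisGroup K), ∀ v ∈ Λ, W.rationalGaloisRepTate p σ v ∈ Λ)
    (hspan : Submodule.span ℚ_[p] (Λ : Set (W.rationalTateModule p)) = ⊤) :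
    ∃ (W' : WeierstrassCurve K) (_ : W'.IsElliptic) (_ : Isogeny W W')
      (e : Λ ≃ₗ[ℤ_[p]] W'.tateModule p),
      ∀ (σ : absoluteGaloisGroup K) (v : W.rationalTateModule p) (hv : v ∈ Λ),
        e ⟨W.rationalGaloisRepTate p σ v, hGal σ v hv⟩ = σ • e ⟨v, hv⟩ := by
  haveI : Module.Finite ℤ_[p] (W.tateModule p) := module_finite_tateModule_holds W p
  set ι : W.tateModule p →ₗ[ℤ_[p]] W.rationalTateModule p := TateModule.toRational p with hιdef
  have hιρ : ∀ (σ : absoluteGaloisGroup K) (x : W.tateModule p),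
      W.rationalGaloisRepTate p σ (ι x) = ι (σ • x) := fun σ x ↦ by
    change rationalTateRepresentation _ _ p σ (TateModule.toRational p x) = _
    rw [rationalTateRepresentation_toRational]
  have hιsmul : ∀ (c : ℤ_[p]) (y : W.tateModule p), ι (c • y) = (c : ℚ_[p]) • ι y :=
    fun c y ↦ by rw [map_smul, ← algebraMap_smul ℚ_[p] c (ι y)]; rfl
  have hιinj : Function.Injective ι := TateModule.toRational_injective
  -- clear denominators: `N₀ • Λ ⊆ T_pE`
  obtain ⟨N₀, hN₀, hN₀Λ⟩ := exists_smul_mem_range_toRational_of_fg' W p hfg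
  have hN₀' : (N₀ : ℚ_[p]) ≠ 0 := PadicInt.coe_ne_zero.mpr hN₀
  -- `L = {x ∈ T_pE | ι x ∈ N₀ • Λ}`
  let φ : W.rationalTateModule p →ₗ[ℤ_[p]] W.rationalTateModule p :=
    DistribSMul.toLinearMap ℤ_[p] (W.rationalTateModule p) (N₀ : ℚ_[p])
  have hφ : ∀ v, φ v = (N₀ : ℚ_[p]) • v := fun v ↦ rfl
  let L : Submodule ℤ_[p] (W.tateModule p) := (Λ.map φ).comap ι
  have hL : ∀ x, x ∈ L ↔ ∃ v ∈ Λ, (N₀ : ℚ_[p]) • v = ι x := fun x ↦ by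
    simp only [L, Submodule.mem_comap, Submodule.mem_map, hφ]
  -- `L` is stable
  have hLst : ∀ (σ : absoluteGaloisGroup K) (x : W.tateModule p), x ∈ L → σ • x ∈ L := by
    intro σ x hx
    obtain ⟨v, hv, hvx⟩ := (hL x).mp hx
    refine (hL _).mpr ⟨W.rationalGaloisRepTate p σ v, hGal σ v hv, ?_⟩
    rw [← map_smul, hvx, hιρ]
  -- `p^n T_pE ⊆ L`
  obtain ⟨n, hn⟩ : ∃ n : ℕ, ∀ x : W.tateModule p, (p : ℤ_[p]) ^ n • x ∈ L := by
    -- each `x ∈ T_pE` has a non-zero multiple in `L`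
    have hx : ∀ x : W.tateModule p, ∃ M : ℤ_[p], M ≠ 0 ∧ M • x ∈ L := by
      intro x
      obtain ⟨M, hM, hMx⟩ := exists_smul_mem_of_mem_span W p Λ
        (w := ι x) (by rw [hspan]; exact Submodule.mem_top)
      refine ⟨N₀ * M, mul_ne_zero hN₀ hM, (hL _).mpr ⟨(M : ℚ_[p]) • ι x, hMx, ?_⟩⟩
      rw [hιsmul, PadicInt.coe_mul, mul_smul]
    obtain ⟨s, hs⟩ := Module.Finite.fg_top (R := ℤ_[p]) (M := W.tateModule p)
    choose M hM0 hM using hx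
    set N : ℤ_[p] := ∏ x ∈ s, M x with hNdef
    have hN0 : N ≠ 0 := Finset.prod_ne_zero_iff.mpr fun x _ ↦ hM0 x
    have hNs : ∀ x ∈ s, N • x ∈ L := by
      intro x hxs
      obtain ⟨R, hR⟩ : ∃ R : ℤ_[p], N = R * M x :=
        ⟨∏ y ∈ s.erase x, M y, (Finset.prod_erase_mul s M hxs).symm⟩
      rw [hR, mul_smul]
      exact L.smul_mem R (hM x)
    have hNall : ∀ x : W.tateModule p, N • x ∈ L := by
      intro x
      have hxs : x ∈ Submodule.span ℤ_[p] (s : Set (W.tateModule p)) := by rw [hs]; exact Submodule.mem_top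
      refine Submodule.span_induction (p := fun x _ ↦ N • x ∈ L) (fun x h ↦ hNs x h)
        (by rw [smul_zero]; exact L.zero_mem) (fun x y _ _ hx hy ↦ ?_) (fun c x _ hx ↦ ?_) hxs
      · rw [smul_add]; exact L.add_mem hx hy
      · rw [smul_comm]; exact L.smul_mem c hx
    refine ⟨N.valuation, fun x ↦ ?_⟩
    have hspec : N = (PadicInt.unitCoeff hN0 : ℤ_[p]) * (p : ℤ_[p]) ^ N.valuation :=
      PadicInt.unitCoeff_spec hN0
    have hu : ((PadicInt.unitCoeff hN0)⁻¹ : ℤ_[p]ˣ) * N = (p : ℤ_[p]) ^ N.valuation :=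
      calc (((PadicInt.unitCoeff hN0)⁻¹ : ℤ_[p]ˣ) : ℤ_[p]) * N
          = (((PadicInt.unitCoeff hN0)⁻¹ : ℤ_[p]ˣ) : ℤ_[p]) *
              ((PadicInt.unitCoeff hN0 : ℤ_[p]) * (p : ℤ_[p]) ^ N.valuation) :=
            congrArg (fun t ↦ (((PadicInt.unitCoeff hN0)⁻¹ : ℤ_[p]ˣ) : ℤ_[p]) * t) hspec
        _ = (p : ℤ_[p]) ^ N.valuation := by rw [← mul_assoc, Units.inv_mul, one_mul]
    rw [← hu, mul_smul]
    exact L.smul_mem _ (hNall x)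
  -- the `T_pE` form
  obtain ⟨W', hW', g, e₁, -, he₁, -⟩ :=
    W.exists_isogeny_tateModule_equiv_of_stableLattice p L hLst hn
  haveI := hW'
  -- `Λ ≅ L`, `v ↦ ι⁻¹ (N₀ • v)`, built from the inverse `x ↦ N₀⁻¹ • ι x`
  have hgmem : ∀ x : L, (N₀ : ℚ_[p])⁻¹ • ι (x : W.tateModule p) ∈ Λ := by
    intro x
    obtain ⟨v, hv, hvx⟩ := (hL _).mp x.2
    rw [← hvx, inv_smul_smul₀ hN₀']
    exact hv
  let g₀ : L →ₗ[ℤ_[p]] Λ :=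
    { toFun := fun x ↦ ⟨(N₀ : ℚ_[p])⁻¹ • ι (x : W.tateModule p), hgmem x⟩
      map_add' := fun x y ↦ Subtype.ext (by simp [map_add, smul_add])
      map_smul' := fun c x ↦ Subtype.ext (by
        simp only [RingHom.id_apply, SetLike.val_smul]
        rw [hιsmul, ← algebraMap_smul ℚ_[p] c ((N₀ : ℚ_[p])⁻¹ • ι (x : W.tateModule p)), smul_comm]
        rfl) }
  have hg₀ : ∀ x : L, ((g₀ x : Λ) : W.rationalTateModule p) = (N₀ : ℚ_[p])⁻¹ • ι (x : W.tateModule p) :=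
    fun _ ↦ rfl
  have hg₀inj : Function.Injective g₀ := by
    intro x y hxy
    have h := congrArg (fun z : Λ ↦ (N₀ : ℚ_[p]) • (z : W.rationalTateModule p)) hxy
    simp only [hg₀, smul_inv_smul₀ hN₀'] at h
    exact Subtype.ext (hιinj h)
  have hg₀surj : Function.Surjective g₀ := by
    rintro ⟨v, hv⟩
    obtain ⟨x, hx⟩ := hN₀Λ v hv
    refine ⟨⟨x, (hL x).mpr ⟨v, hv, hx⟩⟩, Subtype.ext ?_⟩
    change (N₀ : ℚ_[p])⁻¹ • ι x = v
    rw [hιdef, ← hx, inv_smul_smul₀ hN₀']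
  let gL : L ≃ₗ[ℤ_[p]] Λ := LinearEquiv.ofBijective g₀ ⟨hg₀inj, hg₀surj⟩
  have hgL : ∀ x : L, ((gL x : Λ) : W.rationalTateModule p) = (N₀ : ℚ_[p])⁻¹ • ι (x : W.tateModule p) :=
    fun _ ↦ rfl
  refine ⟨W', hW', g, gL.symm.trans e₁, fun σ v hv ↦ ?_⟩
  -- equivariance
  obtain ⟨x, hx⟩ := gL.surjective ⟨v, hv⟩
  have hxv : (N₀ : ℚ_[p])⁻¹ • ι (x : W.tateModule p) = v := by
    rw [← hgL, hx]
  have hσx : gL ⟨σ • (x : W.tateModule p), hLst σ _ x.2⟩ =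
      ⟨W.rationalGaloisRepTate p σ v, hGal σ v hv⟩ := by
    refine Subtype.ext ?_
    change (N₀ : ℚ_[p])⁻¹ • ι (σ • (x : W.tateModule p)) = W.rationalGaloisRepTate p σ v
    rw [← hxv, LinearMap.map_smul (W.rationalGaloisRepTate p σ), hιρ]
  rw [LinearEquiv.trans_apply, LinearEquiv.trans_apply, ← hσx, ← hx, LinearEquiv.symm_apply_apply,
    LinearEquiv.symm_apply_apply]
  exact he₁ σ (x : W.tateModule p) x.2

end Construction

section Rat

variable (W : WeierstrassCurve ℚ) [W.IsElliptic] (p : ℕ) [hp : Fact p.Prime]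

/-- **Kato's member exists, `V_pE` form, globally minimal.** For an elliptic curve `E/ℚ`, a prime
`p` and a finitely generated `Γ_ℚ`-stable `ℤ_p`-lattice `Λ ⊆ V_pE` (spanning `V_pE`), there is a
GLOBALLY MINIMAL elliptic curve `E'/ℚ`, `ℚ`-isogenous to `E`, with a `Γ_ℚ`-equivariant `ℤ_p`-linear
isomorphism `Λ ≅ T_pE'`. With `Λ` = Kato's lattice `V_{ℤ_p}(f)(1) ⊂ V_{ℚ_p}(f)(1) ≅ V_pE`
(Astérisque 295, 8.3 / 14.10 / 17.5) this is the member `E_K` of the isogeny class with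
`T_pE_K ≅ V_{ℤ_p}(f)(1)` of Wuthrich 2014 §3.2 (Silverman *AEC* III.4.12 / Rem. III.4.13.2, III.§7,
VIII.8.3). [cite: SilvermanAEC2009, Prop. III.4.12 with Rem. III.4.13.2, III.7 and Cor. VIII.8.3]
[cite: Kato2004Asterisque, 8.3 (p. 181), 14.10 (p. 241) and 17.5 (p. 274)] [cite: Wuthrich2014, §3.2 (p. 394)] -/
theorem _root_.WeierstrassCurve.exists_isIsogenous_isGloballyMinimal_tateModule_equiv_of_stableRationalLattice
    {Λ : Submodule ℤ_[p] (W.rationalTateModule p)} (hfg : Λ.FG)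
    (hGal : ∀ (σ : absoluteGaloisGroup ℚ), ∀ v ∈ Λ, W.rationalGaloisRepTate p σ v ∈ Λ)
    (hspan : Submodule.span ℚ_[p] (Λ : Set (W.rationalTateModule p)) = ⊤) :
    ∃ (W' : WeierstrassCurve ℚ) (_ : W'.IsElliptic) (_ : W'.IsGloballyMinimal)
      (e : Λ ≃ₗ[ℤ_[p]] W'.tateModule p),
      IsIsogenous W W' ∧
      ∀ (σ : absoluteGaloisGroup ℚ) (v : W.rationalTateModule p) (hv : v ∈ Λ),
        e ⟨W.rationalGaloisRepTate p σ v, hGal σ v hv⟩ = σ • e ⟨v, hv⟩ := by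
  obtain ⟨W₁, hW₁, g, e₁, he₁⟩ :=
    W.exists_isogeny_tateModule_equiv_of_stableRationalLattice p hfg hGal hspan
  haveI := hW₁
  obtain ⟨C, hC⟩ := hasGlobalMinimalModel_rat_holds W₁
  obtain ⟨e₂, -, he₂⟩ := exists_tateModule_equiv_of_isogeny_bijective p (VariableChange.toIsogeny W₁ C)
    ⟨VariableChange.toIsogeny_injective W₁ C, VariableChange.toIsogeny_surjective W₁ C⟩
  refine ⟨C • W₁, inferInstance, hC, e₁.trans e₂, IsIsogenous.trans' ⟨g⟩ (isIsogenous_smul W₁ C),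
    fun σ v hv ↦ ?_⟩
  rw [LinearEquiv.trans_apply, LinearEquiv.trans_apply, he₁, he₂]

end Rat

end Literature.NumberTheory.EllipticCurves

end
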